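/-
Copyright (c) 2026 the pub-hodgecm-mathlib formalisation cell (harness21).  Prover seat hodgecm-mathlib-F0P2-p01 (g16): road «S3-ram» (LEAD F0P3a-plan (g13); owner F0P3a-p06),
(T2) G-side organ (Cnt2′) (chair F0P3a-p07 (g15) RULING (13)), organ (z1-c) «TUBE LAYERS b ≥ 1», PART II(b=1) «COLLAR TOKENS» — (K2₂) the RANK token; 2026-09-02.
-/
import Literature.NumberTheory.Automorphic.UnitaryLatticeTreeTubeCollarTokens   -- ★ p848616 (this seat): (K0–K3), `collar_levSq_of_axisLevel`, block bookkeeping `endoGL_sub_one_*`; brings ★ TubeCone ∕ TubeAxisVertex ∕ TubeCoordinate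
import HarnessLib

/-!
# The lattice graph of a hermitian space — COLLAR TOKENS (K2₂): the RANK token `LEV₂(ϖ^{2D−1})` of a collar lattice below a level-`D` axis vertex is read on the residual value
# of the SQUARE, `ϖ^{−2D}⟨x, (Γ − 1)²x⟩` (Kottwitz 1986 §3; Rogawski 1990 §4.9)

Topic `NumberTheory/Automorphic`; namespace `Literature.NumberTheory.Automorphic.UnitaryLatticeTree`.  THEOREMS ONLY (no definition, no instance, no notation, no named fact,
no `sorry`); kernel lane `--supports stmt-HodgeConjecture-24833`; datum-free (`K` with `Valued K ℤᵐ⁰`, `[IsPrincipalIdealRing 𝒪[K]]`).  Cell `pub/hodgecm-mathlib` (D-0151),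
crux H413; road «S3-ram» (Literature seeding, count-neutral); (T2) G-side organ (Cnt2′), organ (z1-c) «TUBE LAYERS b ≥ 1», PART II(b=1) «COLLAR TOKENS» (★ p848616: K0 fixed,
K1 `LEV(ϖ^{D−2})` and `LEV₂(ϖ^{2D−2})` (`collar_levSq_of_axisLevel`), K2 `LEV(ϖ^{D−1}) ⟺ |val| < 1`, K3 class; ★ p848891 K4) — here the missing iff ONE LEVEL UP for the square:
offered 2026-09-02T04:37:47Z to F0P3a-p04 (g20)'s «(K2-even) A-even anisotropic root: all `(q+1)q` root grandchildren are `O`» (the `O`-vs-`E∕P±` discriminator at EVEN `d₀` is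
exactly `¬LEV₂(ϖ^{2d₀−1})`), PARITY-FREE, ANY unit-det hermitian `H₂`, ANY axis vertex.
BLOCK CURRENCY as in ★ p848616: `H = !![H₂ 0 0, 0, H₂ 0 1; 0, h, 0; H₂ 1 0, 0, H₂ 1 1]`, `Γ = ι(γ₂, u) = endoGL (γ₂, u)`, `Y := Γ − 1`, `S := Y·Y`, `δ := u₀₀ − 1` (`S₁₁ = δ²`);
`M` self-dual with tube coordinate `1`, generator `x₀`, axis vertex `A(M) = (M ∩ W) ⊔ ϖM ⊔ 𝒪e₁` with `Y·A(M) ⊆ ϖ^D A(M)`, `D ≥ 2`; `x := ϖx₀`, `z := ϖ(x₀ − x₀(1)e₁)`,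
`val₂ := ϖ^{−2D}⟨x, Sx⟩`.

THE MATHEMATICS.  By the LEV law on the cone (★ (c3-iv′) `forall_mulVec_mem_scaleLattice_iff_of_cone` at `T := S`, `c := ϖ^{2D−1}`; `S` is block at `1` by ★ `endoGL_sub_one_sq_col`
and its row twin §0), `LEV₂[M](ϖ^{2D−1})` is the conjunction of (a) `|δ²| ≤ |ϖ|^{2D−1}` (from `|δ| ≤ |ϖ|^D`), (b) `S(M ∩ W) ⊆ ϖ^{2D−1}M` (`Y` twice: `Y(M ∩ W) ⊆ ϖ^D A(M)`,
`Y(ϖ^D A(M)) ⊆ ϖ^{2D}A(M) ⊆ ϖ^{2D−1}M`), (c) `(S − δ²)z ∈ ϖ^{2D}A(M)` (`(S − δ²)z = (Y + δ)((Γ − u₀₀)z)` with `(Γ − u₀₀)z ∈ ϖ^D A(M)`) — all three AUTOMATIC, as in ★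
`collar_levSq_of_axisLevel` — and the value clause (d) `|⟨z, (S − δ²)z⟩| ≤ |ϖ|^{2D+1}`, which reads `|val₂| < 1` because `⟨x, Sx⟩ − ⟨z, (S − δ²)z⟩ = δ²(⟨z,z⟩ + hN(ϖx₀(1)))
∈ ϖ^{2D+2}𝒪` (§0 `pairing_add_single_block_apply`, ★ (c3-ii) integral isotropy of the glued generator).  Hence **(K2₂) `LEV₂[M](ϖ^{2D−1}) ⟺ |val₂| < 1`**.

* §0 `endoGL_sub_one_sq_row`, `pairing_add_single_block_apply` (bookkeeping: `⟨z + te₁, S(z + te₁)⟩ = ⟨z, (S − S₁₁)z⟩ + S₁₁(⟨z,z⟩ + σ(t)ht)` for a block `S` and `z ∈ W`).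
* §1 **`collar_levSq_iff_of_axisLevel`** (K2₂).

HONEST LABEL: HC_CM is proved only modulo the 2 remaining named inputs (hLiu418 24832, h413 24833) until rung 0 closes; nothing printed is asserted here (elementary lattice
algebra over a discretely valued field); «S3-ram» has no books consequence.

## References
* [Kottwitz1986] R. E. Kottwitz, *Base change for unit elements of Hecke algebras*, Compositio Math. 60 (1986), §3 (depth tokens of fixed lattices).
* [Rogawski1990] J. D. Rogawski, *Automorphic Representations of Unitary Groups in Three Variables*, Ann. of Math. Stud. 123 (1990), §4.8 Case (a) p. 53, §4.9 p. 55.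
* [BruhatTits1972] F. Bruhat, J. Tits, *Groupes réductifs sur un corps local I*, Publ. Math. IHÉS 41 (1972), §10.
-/

set_option autoImplicit false

noncomputable section

open scoped Valued WithZero Matrix MatrixGroups

namespace Literature.NumberTheory.Automorphic.UnitaryLatticeTree

open Literature.NumberTheory.Automorphic Literature.NumberTheory.Automorphic.HermitianLattice Literature.NumberTheory.Rogawski1990

variable {K : Type*} [Field K] [Valued K ℤᵐ⁰]

/-! ## §0 Bookkeeping -/

omit [Valued K ℤᵐ⁰] in
/-- `(Γ − 1)²` is block at `1` on the ROW side too: `((Γ−1)²)_{1l} = 0` for `l ≠ 1`. [cite: Rogawski1990, §4.8 Case (a) p. 53] -/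
theorem endoGL_sub_one_sq_row (γ₂ : GL (Fin 2) K) (u : GL (Fin 1) K) (l : Fin 3) (hl : l ≠ 1) :
    ((((endoGL (γ₂, u) : GL (Fin 3) K) : Matrix (Fin 3) (Fin 3) K) - 1) * (((endoGL (γ₂, u) : GL (Fin 3) K) : Matrix (Fin 3) (Fin 3) K) - 1)) 1 l = 0 := by
  have hrow := endoGL_sub_one_row γ₂ u
  rw [Matrix.mul_apply, Fin.sum_univ_three, hrow 0 (by decide), hrow 2 (by decide), zero_mul, zero_mul, zero_add, add_zero, hrow l hl, mul_zero]

omit [Valued K ℤᵐ⁰] in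
/-- **Value of a glued vector against a block operator**: for `S` block at `1` (rows and columns), `z ∈ W` (`z(1) = 0`) and `t ∈ K`:
`⟨z + te₁, S(z + te₁)⟩ = ⟨z, (S − S₁₁·1)z⟩ + S₁₁·(⟨z, z⟩ + σ(t)·h·t)`. [cite: Jacobowitz1962, §4] [cite: Rogawski1990, §4.8 Case (a) p. 53] -/
theorem pairing_add_single_block_apply (σ : K →+* K) (H₂ : Matrix (Fin 2) (Fin 2) K) (h : K) {S : Matrix (Fin 3) (Fin 3) K}
    (hcol : ∀ l, l ≠ 1 → S l 1 = 0) (hrow : ∀ l, l ≠ 1 → S 1 l = 0) {z : Fin 3 → K} (hz : z 1 = 0) (t : K) :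
    pairing σ (!![H₂ 0 0, 0, H₂ 0 1; 0, h, 0; H₂ 1 0, 0, H₂ 1 1] : Matrix (Fin 3) (Fin 3) K) (z + Pi.single 1 t) (S *ᵥ (z + Pi.single 1 t)) =
      pairing σ (!![H₂ 0 0, 0, H₂ 0 1; 0, h, 0; H₂ 1 0, 0, H₂ 1 1] : Matrix (Fin 3) (Fin 3) K) z ((S - S 1 1 • (1 : Matrix (Fin 3) (Fin 3) K)) *ᵥ z) + S 1 1 * (pairing σ (!![H₂ 0 0, 0, H₂ 0 1; 0, h, 0; H₂ 1 0, 0, H₂ 1 1] : Matrix (Fin 3) (Fin 3) K) z z + σ t * h * t) := by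
  have hHrow := endoShapeForm_row H₂ h
  have hHcol := endoShapeForm_col H₂ h
  have hSz1 : (S *ᵥ z) 1 = 0 := by
    simp only [Matrix.mulVec, dotProduct, Fin.sum_univ_three, hrow 0 (by decide), hrow 2 (by decide), hz, mul_zero, zero_mul, add_zero]
  rw [Matrix.mulVec_add, mulVec_single_one_of_block hcol, sub_smul_one_mulVec]
  simp only [map_add, LinearMap.add_apply, LinearMap.map_sub, LinearMap.map_smul, smul_eq_mul,
    pairing_single_right_of_block σ _ 1 hHcol, pairing_single_left_of_block σ _ 1 hHrow, hz, hSz1, endoShapeForm_one_one,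
    map_zero, zero_mul, mul_zero, add_zero, zero_add, Pi.single_eq_same]
  ring

/-! ## §1 (K2₂) THE RANK TOKEN OF A COLLAR LATTICE -/

/-- **COLLAR RANK TOKEN (K2₂).**  In the situation of ★ `collar_fixed_and_lev_of_axisLevel` (block form, `Γ = ι(γ₂, u)`, `M` self-dual with tube coordinate `1` and generator
`x₀`, axis vertex `A(M)` with `(Γ − 1)A(M) ⊆ ϖ^D A(M)`, `D ≥ 2`): **`LEV₂[M](ϖ^{2D−1}) ⟺ |ϖ^{−2D}⟨ϖx₀, (Γ − 1)²(ϖx₀)⟩| < 1`** — one level above the automatic `LEV₂(ϖ^{2D−2})` of ★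
`collar_levSq_of_axisLevel`, the rank token is read on the residual value of the SQUARE along the line of `M`.  At EVEN top depth this is the `O`-vs-`E∕P±` discriminator.
[cite: Kottwitz1986, §3] [cite: Rogawski1990, §4.9 p. 55] [cite: BruhatTits1972, §10] -/
theorem collar_levSq_iff_of_axisLevel [IsPrincipalIdealRing 𝒪[K]] (σ : K →+* K) (hσ : ∀ a, σ (σ a) = a) (hvσ : ∀ a, Valued.v (σ a) = Valued.v a)
    {ϖ : K} (hϖ : Valued.v ϖ = WithZero.exp (-1 : ℤ))
    {H₂ : Matrix (Fin 2) (Fin 2) K} (hH₂ : IsUnit H₂.det) (hH₂σ : (H₂.map σ)ᵀ = H₂) {h : K} (hh : Valued.v h = 1) (hhσ : σ h = h)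
    {M : Submodule 𝒪[K] (Fin 3 → K)} (hM : IsSelfDualLattice σ ϖ (!![H₂ 0 0, 0, H₂ 0 1; 0, h, 0; H₂ 1 0, 0, H₂ 1 1] : Matrix (Fin 3) (Fin 3) K) M)
    (hb : ∀ a : K, (Pi.single 1 a : Fin 3 → K) ∈ M ↔ Valued.v a ≤ Valued.v ϖ ^ 1)
    {x₀ : Fin 3 → K} (hx₀ : x₀ ∈ M) (hx₀1 : Valued.v (x₀ 1) * Valued.v ϖ ^ 1 = 1)
    (γ₂ : GL (Fin 2) K) (u : GL (Fin 1) K) {D : ℕ} (hD : 2 ≤ D)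
    (hAlev : ∀ a ∈ M ⊓ LinearMap.ker ((LinearMap.proj (1 : Fin 3) : (Fin 3 → K) →ₗ[K] K).restrictScalars 𝒪[K]) ⊔ scaleLattice (ϖ ^ 1) M ⊔ Submodule.span 𝒪[K] {(Pi.single 1 1 : Fin 3 → K)}, (((endoGL (γ₂, u) : GL (Fin 3) K) : Matrix (Fin 3) (Fin 3) K) - 1) *ᵥ a ∈ scaleLattice (ϖ ^ D) (M ⊓ LinearMap.ker ((LinearMap.proj (1 : Fin 3) : (Fin 3 → K) →ₗ[K] K).restrictScalars 𝒪[K]) ⊔ scaleLattice (ϖ ^ 1) M ⊔ Submodule.span 𝒪[K] {(Pi.single 1 1 : Fin 3 → K)})) :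
    (∀ y ∈ M, ((((endoGL (γ₂, u) : GL (Fin 3) K) : Matrix (Fin 3) (Fin 3) K) - 1) * (((endoGL (γ₂, u) : GL (Fin 3) K) : Matrix (Fin 3) (Fin 3) K) - 1)) *ᵥ y ∈ scaleLattice (ϖ ^ (2 * D - 1)) M) ↔
      Valued.v ((ϖ ^ (2 * D))⁻¹ * pairing σ (!![H₂ 0 0, 0, H₂ 0 1; 0, h, 0; H₂ 1 0, 0, H₂ 1 1] : Matrix (Fin 3) (Fin 3) K) (ϖ • x₀) (((((endoGL (γ₂, u) : GL (Fin 3) K) : Matrix (Fin 3) (Fin 3) K) - 1) * (((endoGL (γ₂, u) : GL (Fin 3) K) : Matrix (Fin 3) (Fin 3) K) - 1)) *ᵥ (ϖ • x₀))) < 1 := by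
  have hY11 := endoGL_sub_one_apply_one_one γ₂ u
  have hYu := endoGL_sub_one_sub_smul_one γ₂ u
  have hYcol := endoGL_sub_one_col γ₂ u
  obtain ⟨hScol, hS11⟩ := endoGL_sub_one_sq_col γ₂ u
  have hSrow := endoGL_sub_one_sq_row γ₂ u
  have hϖ0' : Valued.v ϖ ≠ 0 := by rw [hϖ]; exact WithZero.exp_ne_zero
  have hϖ0 : ϖ ≠ 0 := fun h0 => by rw [h0, map_zero] at hϖ0'; exact hϖ0' rfl
  have hϖlt : Valued.v ϖ < 1 := by rw [hϖ, ← WithZero.exp_zero, WithZero.exp_lt_exp]; omega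
  have hϖ1 : Valued.v ϖ ≤ 1 := hϖlt.le
  have hϖD0 : ϖ ^ D ≠ 0 := pow_ne_zero _ hϖ0
  have hϖD0' : Valued.v ϖ ^ D ≠ 0 := pow_ne_zero _ hϖ0'
  have hϖ2D0' : Valued.v ϖ ^ (2 * D) ≠ 0 := pow_ne_zero _ hϖ0'
  have hb1 : 1 ≤ 1 := le_refl 1
  obtain ⟨he₁A, hA1, hASD⟩ := isSelfDualLattice_axisVertex_of_tubeCoordinate σ hσ hvσ hϖ hH₂ hH₂σ hh hhσ hM hb
  have hAint := le_dualLatt_of_isVertexLattice hvσ hASD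
  obtain ⟨hzA, -, hziso, -⟩ := cone_anatomy_of_tubeCoordinate σ hvσ hϖ hH₂ hh hM hb1 hb hx₀ hx₀1
  have hϖA := scaleLattice_axisVertex_le hϖ hb
  -- `|δ| ≤ |ϖ|^D`
  have hδ : Valued.v ((u : Matrix (Fin 1) (Fin 1) K) 0 0 - 1) ≤ Valued.v ϖ ^ D := by
    have h1 := hAlev _ he₁A
    rw [mulVec_single_one_of_block hYcol, hY11, mul_one, mem_scaleLattice_iff hϖD0] at h1
    have e : (ϖ ^ D)⁻¹ • (Pi.single 1 ((u : Matrix (Fin 1) (Fin 1) K) 0 0 - 1) : Fin 3 → K) = Pi.single 1 ((ϖ ^ D)⁻¹ * ((u : Matrix (Fin 1) (Fin 1) K) 0 0 - 1)) := by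
      ext k; rcases eq_or_ne k 1 with rfl | hk <;> simp [*]
    rw [e] at h1
    have h2 := hA1 _ h1
    rw [Pi.single_eq_same, map_mul, map_inv₀, map_pow, inv_mul_le_iff₀ (zero_lt_iff.2 hϖD0'), mul_one] at h2
    exact h2
  have hδA : ∀ a ∈ M ⊓ LinearMap.ker ((LinearMap.proj (1 : Fin 3) : (Fin 3 → K) →ₗ[K] K).restrictScalars 𝒪[K]) ⊔ scaleLattice (ϖ ^ 1) M ⊔ Submodule.span 𝒪[K] {(Pi.single 1 1 : Fin 3 → K)}, ((u : Matrix (Fin 1) (Fin 1) K) 0 0 - 1) • a ∈ scaleLattice (ϖ ^ D) (M ⊓ LinearMap.ker ((LinearMap.proj (1 : Fin 3) : (Fin 3 → K) →ₗ[K] K).restrictScalars 𝒪[K]) ⊔ scaleLattice (ϖ ^ 1) M ⊔ Submodule.span 𝒪[K] {(Pi.single 1 1 : Fin 3 → K)}) := fun a ha => by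
    rw [mem_scaleLattice_iff hϖD0, smul_smul]
    exact smul_mem_of_v_le _ (by rw [map_mul, map_inv₀, map_pow, inv_mul_le_iff₀ (zero_lt_iff.2 hϖD0'), mul_one]; exact hδ) ha
  -- `Y v + t v ∈ ϖ^{2D}·A(M)` for `v ∈ ϖ^D·A(M)`, `|t| ≤ |ϖ|^D`
  have hstepA : ∀ v ∈ scaleLattice (ϖ ^ D) (M ⊓ LinearMap.ker ((LinearMap.proj (1 : Fin 3) : (Fin 3 → K) →ₗ[K] K).restrictScalars 𝒪[K]) ⊔ scaleLattice (ϖ ^ 1) M ⊔ Submodule.span 𝒪[K] {(Pi.single 1 1 : Fin 3 → K)}), ∀ t : K, Valued.v t ≤ Valued.v ϖ ^ D →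
      (((endoGL (γ₂, u) : GL (Fin 3) K) : Matrix (Fin 3) (Fin 3) K) - 1) *ᵥ v + t • v ∈ scaleLattice (ϖ ^ (D + D)) (M ⊓ LinearMap.ker ((LinearMap.proj (1 : Fin 3) : (Fin 3 → K) →ₗ[K] K).restrictScalars 𝒪[K]) ⊔ scaleLattice (ϖ ^ 1) M ⊔ Submodule.span 𝒪[K] {(Pi.single 1 1 : Fin 3 → K)}) := by
    intro v hv t ht
    rw [mem_scaleLattice_iff hϖD0] at hv
    have e : v = (ϖ ^ D) • ((ϖ ^ D)⁻¹ • v) := by rw [smul_smul, mul_inv_cancel₀ hϖD0, one_smul]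
    have h1 : (((endoGL (γ₂, u) : GL (Fin 3) K) : Matrix (Fin 3) (Fin 3) K) - 1) *ᵥ v + t • v ∈ scaleLattice (ϖ ^ D) (scaleLattice (ϖ ^ D) (M ⊓ LinearMap.ker ((LinearMap.proj (1 : Fin 3) : (Fin 3 → K) →ₗ[K] K).restrictScalars 𝒪[K]) ⊔ scaleLattice (ϖ ^ 1) M ⊔ Submodule.span 𝒪[K] {(Pi.single 1 1 : Fin 3 → K)})) := by
      rw [e, Matrix.mulVec_smul, smul_comm t (ϖ ^ D), ← smul_add]
      rw [scaleLattice, Submodule.mem_map]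
      refine ⟨(((endoGL (γ₂, u) : GL (Fin 3) K) : Matrix (Fin 3) (Fin 3) K) - 1) *ᵥ ((ϖ ^ D)⁻¹ • v) + t • ((ϖ ^ D)⁻¹ • v), Submodule.add_mem _ (hAlev _ hv) ?_, rfl⟩
      rw [mem_scaleLattice_iff hϖD0, smul_smul]
      exact smul_mem_of_v_le _ (by rw [map_mul, map_inv₀, map_pow, inv_mul_le_iff₀ (zero_lt_iff.2 hϖD0'), mul_one]; exact ht) hv
    rwa [scaleLattice_scaleLattice, ← pow_add] at h1
  -- `ϖ^{2D}·A(M) ≤ ϖ^{2D−1}·M`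
  have h2DA : scaleLattice (ϖ ^ (D + D)) (M ⊓ LinearMap.ker ((LinearMap.proj (1 : Fin 3) : (Fin 3 → K) →ₗ[K] K).restrictScalars 𝒪[K]) ⊔ scaleLattice (ϖ ^ 1) M ⊔ Submodule.span 𝒪[K] {(Pi.single 1 1 : Fin 3 → K)}) ≤ scaleLattice (ϖ ^ (2 * D - 1)) M := by
    calc scaleLattice (ϖ ^ (D + D)) (M ⊓ LinearMap.ker ((LinearMap.proj (1 : Fin 3) : (Fin 3 → K) →ₗ[K] K).restrictScalars 𝒪[K]) ⊔ scaleLattice (ϖ ^ 1) M ⊔ Submodule.span 𝒪[K] {(Pi.single 1 1 : Fin 3 → K)}) = scaleLattice (ϖ ^ (2 * D - 1)) (scaleLattice (ϖ ^ 1) (M ⊓ LinearMap.ker ((LinearMap.proj (1 : Fin 3) : (Fin 3 → K) →ₗ[K] K).restrictScalars 𝒪[K]) ⊔ scaleLattice (ϖ ^ 1) M ⊔ Submodule.span 𝒪[K] {(Pi.single 1 1 : Fin 3 → K)})) := by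
          rw [scaleLattice_scaleLattice, ← pow_add, show 2 * D - 1 + 1 = D + D by omega]
      _ ≤ scaleLattice (ϖ ^ (2 * D - 1)) M := scaleLattice_mono _ hϖA
  have hcone := forall_mulVec_mem_scaleLattice_iff_of_cone σ hvσ hϖ hH₂ hh hM hb1 hb hx₀ hx₀1 hScol hSrow (pow_ne_zero (2 * D - 1) hϖ0)
  rw [hcone]
  -- (a) the scalar
  have ha : Valued.v (((((endoGL (γ₂, u) : GL (Fin 3) K) : Matrix (Fin 3) (Fin 3) K) - 1) * (((endoGL (γ₂, u) : GL (Fin 3) K) : Matrix (Fin 3) (Fin 3) K) - 1)) 1 1) ≤ Valued.v (ϖ ^ (2 * D - 1)) := by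
    rw [hS11, map_pow, map_pow]
    refine (pow_le_pow_left₀ zero_le hδ 2).trans ?_
    rw [← pow_mul]; exact (v_pow_le_v_pow_iff hϖ (D * 2) (2 * D - 1)).2 (by omega)
  -- (b) the `W`-clause
  have hW : ∀ w ∈ M, w 1 = 0 → ((((endoGL (γ₂, u) : GL (Fin 3) K) : Matrix (Fin 3) (Fin 3) K) - 1) * (((endoGL (γ₂, u) : GL (Fin 3) K) : Matrix (Fin 3) (Fin 3) K) - 1)) *ᵥ w ∈ scaleLattice (ϖ ^ (2 * D - 1)) M := by
    intro w hw hw1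
    have hwA : w ∈ M ⊓ LinearMap.ker ((LinearMap.proj (1 : Fin 3) : (Fin 3 → K) →ₗ[K] K).restrictScalars 𝒪[K]) ⊔ scaleLattice (ϖ ^ 1) M ⊔ Submodule.span 𝒪[K] {(Pi.single 1 1 : Fin 3 → K)} := Submodule.mem_sup_left (Submodule.mem_sup_left ⟨hw, (mem_kerProj_one_iff w).2 hw1⟩)
    rw [← Matrix.mulVec_mulVec]
    have h1 := hstepA _ (hAlev w hwA) 0 (by rw [map_zero]; exact zero_le)
    rw [zero_smul, add_zero] at h1
    exact h2DA h1
  -- (c) the generator clause: `(S − δ²)z = (Y + δ)((Γ − u)z)` with `(Γ − u)z ∈ ϖ^D A(M)`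
  have hgenD : (((endoGL (γ₂, u) : GL (Fin 3) K) : Matrix (Fin 3) (Fin 3) K) - (u : Matrix (Fin 1) (Fin 1) K) 0 0 • (1 : Matrix (Fin 3) (Fin 3) K)) *ᵥ ((ϖ ^ 1) • (x₀ - Pi.single 1 (x₀ 1))) ∈ scaleLattice (ϖ ^ D) (M ⊓ LinearMap.ker ((LinearMap.proj (1 : Fin 3) : (Fin 3 → K) →ₗ[K] K).restrictScalars 𝒪[K]) ⊔ scaleLattice (ϖ ^ 1) M ⊔ Submodule.span 𝒪[K] {(Pi.single 1 1 : Fin 3 → K)}) := by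
    have e : (((endoGL (γ₂, u) : GL (Fin 3) K) : Matrix (Fin 3) (Fin 3) K) - (u : Matrix (Fin 1) (Fin 1) K) 0 0 • (1 : Matrix (Fin 3) (Fin 3) K)) *ᵥ ((ϖ ^ 1) • (x₀ - Pi.single 1 (x₀ 1))) = (((endoGL (γ₂, u) : GL (Fin 3) K) : Matrix (Fin 3) (Fin 3) K) - 1) *ᵥ ((ϖ ^ 1) • (x₀ - Pi.single 1 (x₀ 1))) - ((u : Matrix (Fin 1) (Fin 1) K) 0 0 - 1) • ((ϖ ^ 1) • (x₀ - Pi.single 1 (x₀ 1))) := by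
      rw [← hYu, sub_smul_one_mulVec, hY11]
    rw [e]; exact Submodule.sub_mem _ (hAlev _ hzA) (hδA _ hzA)
  have efac : ∀ v : Fin 3 → K, (((((endoGL (γ₂, u) : GL (Fin 3) K) : Matrix (Fin 3) (Fin 3) K) - 1) * (((endoGL (γ₂, u) : GL (Fin 3) K) : Matrix (Fin 3) (Fin 3) K) - 1)) - ((((endoGL (γ₂, u) : GL (Fin 3) K) : Matrix (Fin 3) (Fin 3) K) - 1) * (((endoGL (γ₂, u) : GL (Fin 3) K) : Matrix (Fin 3) (Fin 3) K) - 1)) 1 1 • (1 : Matrix (Fin 3) (Fin 3) K)) *ᵥ v =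
      (((endoGL (γ₂, u) : GL (Fin 3) K) : Matrix (Fin 3) (Fin 3) K) - 1) *ᵥ ((((endoGL (γ₂, u) : GL (Fin 3) K) : Matrix (Fin 3) (Fin 3) K) - (u : Matrix (Fin 1) (Fin 1) K) 0 0 • (1 : Matrix (Fin 3) (Fin 3) K)) *ᵥ v) + ((u : Matrix (Fin 1) (Fin 1) K) 0 0 - 1) • ((((endoGL (γ₂, u) : GL (Fin 3) K) : Matrix (Fin 3) (Fin 3) K) - (u : Matrix (Fin 1) (Fin 1) K) 0 0 • (1 : Matrix (Fin 3) (Fin 3) K)) *ᵥ v) := fun v => by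
    rw [sub_smul_one_mulVec, hS11, ← hYu, sub_smul_one_mulVec, hY11, Matrix.mulVec_sub, Matrix.mulVec_smul, ← Matrix.mulVec_mulVec, smul_sub, smul_smul, sq]
    abel
  have hc : (((((endoGL (γ₂, u) : GL (Fin 3) K) : Matrix (Fin 3) (Fin 3) K) - 1) * (((endoGL (γ₂, u) : GL (Fin 3) K) : Matrix (Fin 3) (Fin 3) K) - 1)) - ((((endoGL (γ₂, u) : GL (Fin 3) K) : Matrix (Fin 3) (Fin 3) K) - 1) * (((endoGL (γ₂, u) : GL (Fin 3) K) : Matrix (Fin 3) (Fin 3) K) - 1)) 1 1 • (1 : Matrix (Fin 3) (Fin 3) K)) *ᵥ ((ϖ ^ 1) • (x₀ - Pi.single 1 (x₀ 1))) ∈ scaleLattice (ϖ ^ 1 * ϖ ^ (2 * D - 1)) (M ⊓ LinearMap.ker ((LinearMap.proj (1 : Fin 3) : (Fin 3 → K) →ₗ[K] K).restrictScalars 𝒪[K]) ⊔ scaleLattice (ϖ ^ 1) M ⊔ Submodule.span 𝒪[K] {(Pi.single 1 1 : Fin 3 → K)}) := by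
    rw [← pow_add, show 1 + (2 * D - 1) = D + D by omega, efac]
    exact hstepA _ hgenD _ hδ
  -- (d) the value clause ⟺ `|val₂| < 1`
  have hx : (ϖ • x₀ : Fin 3 → K) = ((ϖ ^ 1) • (x₀ - Pi.single 1 (x₀ 1))) + Pi.single 1 (ϖ * x₀ 1) := by
    ext k; rcases eq_or_ne k 1 with rfl | hk
    · simp
    · simp [hk]
  have hz1 : (((ϖ ^ 1) • (x₀ - Pi.single 1 (x₀ 1))) : Fin 3 → K) 1 = 0 := by simp
  have hcv := pairing_add_single_block_apply σ H₂ h hScol hSrow hz1 (ϖ * x₀ 1)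
  have hBsmall : Valued.v (((((endoGL (γ₂, u) : GL (Fin 3) K) : Matrix (Fin 3) (Fin 3) K) - 1) * (((endoGL (γ₂, u) : GL (Fin 3) K) : Matrix (Fin 3) (Fin 3) K) - 1)) 1 1 * (pairing σ (!![H₂ 0 0, 0, H₂ 0 1; 0, h, 0; H₂ 1 0, 0, H₂ 1 1] : Matrix (Fin 3) (Fin 3) K) ((ϖ ^ 1) • (x₀ - Pi.single 1 (x₀ 1))) ((ϖ ^ 1) • (x₀ - Pi.single 1 (x₀ 1))) + σ (ϖ * x₀ 1) * h * (ϖ * x₀ 1))) ≤ Valued.v ϖ ^ (2 * D) * Valued.v ϖ ^ 2 := by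
    rw [map_mul]
    refine mul_le_mul' ?_ ?_
    · rw [hS11, map_pow]
      refine (pow_le_pow_left₀ zero_le hδ 2).trans ?_
      rw [← pow_mul, mul_comm]
    · have e : σ (ϖ * x₀ 1) * h * (ϖ * x₀ 1) = h * σ (ϖ ^ 1 * x₀ 1) * (ϖ ^ 1 * x₀ 1) := by rw [pow_one]; ring
      have hz2 := hziso
      rw [mul_one] at hz2
      rw [e]; exact hz2
  have hB' : Valued.v (((((endoGL (γ₂, u) : GL (Fin 3) K) : Matrix (Fin 3) (Fin 3) K) - 1) * (((endoGL (γ₂, u) : GL (Fin 3) K) : Matrix (Fin 3) (Fin 3) K) - 1)) 1 1 * (pairing σ (!![H₂ 0 0, 0, H₂ 0 1; 0, h, 0; H₂ 1 0, 0, H₂ 1 1] : Matrix (Fin 3) (Fin 3) K) ((ϖ ^ 1) • (x₀ - Pi.single 1 (x₀ 1))) ((ϖ ^ 1) • (x₀ - Pi.single 1 (x₀ 1))) + σ (ϖ * x₀ 1) * h * (ϖ * x₀ 1))) < Valued.v ϖ ^ (2 * D) * Valued.v ϖ := by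
    refine lt_of_le_of_lt hBsmall ?_
    rw [pow_two, ← mul_assoc]
    exact mul_lt_of_lt_one_right (zero_lt_iff.2 (mul_ne_zero hϖ2D0' hϖ0')) hϖlt
  -- `|y| < 1 ⟺ |y| ≤ |ϖ|`
  have hlt_iff : ∀ y : K, Valued.v y < 1 ↔ Valued.v y ≤ Valued.v ϖ := fun y => by
    rw [hϖ]
    constructor
    · intro hy
      by_cases h0 : Valued.v y = 0
      · rw [h0]; exact zero_le
      · rw [← WithZero.exp_log h0, ← WithZero.exp_zero, WithZero.exp_lt_exp] at hy
        rw [← WithZero.exp_log h0, WithZero.exp_le_exp]; omega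
    · intro hy; exact lt_of_le_of_lt hy (by rw [← WithZero.exp_zero, WithZero.exp_lt_exp]; omega)
  have hpow : Valued.v ϖ ^ (2 * 1) * Valued.v (ϖ ^ (2 * D - 1)) = Valued.v ϖ ^ (2 * D) * Valued.v ϖ := by
    rw [map_pow, ← pow_add, ← pow_succ, show 2 * 1 + (2 * D - 1) = 2 * D + 1 by omega]
  have hval_iff : Valued.v (pairing σ (!![H₂ 0 0, 0, H₂ 0 1; 0, h, 0; H₂ 1 0, 0, H₂ 1 1] : Matrix (Fin 3) (Fin 3) K) ((ϖ ^ 1) • (x₀ - Pi.single 1 (x₀ 1))) ((((((endoGL (γ₂, u) : GL (Fin 3) K) : Matrix (Fin 3) (Fin 3) K) - 1) * (((endoGL (γ₂, u) : GL (Fin 3) K) : Matrix (Fin 3) (Fin 3) K) - 1)) - ((((endoGL (γ₂, u) : GL (Fin 3) K) : Matrix (Fin 3) (Fin 3) K) - 1) * (((endoGL (γ₂, u) : GL (Fin 3) K) : Matrix (Fin 3) (Fin 3) K) - 1)) 1 1 • (1 : Matrix (Fin 3) (Fin 3) K)) *ᵥ ((ϖ ^ 1) • (x₀ - Pi.single 1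 (x₀ 1))))) ≤ Valued.v ϖ ^ (2 * 1) * Valued.v (ϖ ^ (2 * D - 1)) ↔
      Valued.v ((ϖ ^ (2 * D))⁻¹ * pairing σ (!![H₂ 0 0, 0, H₂ 0 1; 0, h, 0; H₂ 1 0, 0, H₂ 1 1] : Matrix (Fin 3) (Fin 3) K) (ϖ • x₀) (((((endoGL (γ₂, u) : GL (Fin 3) K) : Matrix (Fin 3) (Fin 3) K) - 1) * (((endoGL (γ₂, u) : GL (Fin 3) K) : Matrix (Fin 3) (Fin 3) K) - 1)) *ᵥ (ϖ • x₀))) < 1 := by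
    rw [hpow, hlt_iff, map_mul, map_inv₀, map_pow, inv_mul_le_iff₀ (zero_lt_iff.2 hϖ2D0'), hx, hcv]
    constructor
    · intro hd
      exact (Valuation.map_add _ _ _).trans (max_le hd hB'.le)
    · intro hsum
      have e : pairing σ (!![H₂ 0 0, 0, H₂ 0 1; 0, h, 0; H₂ 1 0, 0, H₂ 1 1] : Matrix (Fin 3) (Fin 3) K) ((ϖ ^ 1) • (x₀ - Pi.single 1 (x₀ 1))) ((((((endoGL (γ₂, u) : GL (Fin 3) K) : Matrix (Fin 3) (Fin 3) K) - 1) * (((endoGL (γ₂, u) : GL (Fin 3) K) : Matrix (Fin 3) (Fin 3) K) - 1)) - ((((endoGL (γ₂, u) : GL (Fin 3) K) : Matrix (Fin 3) (Fin 3) K) - 1) * (((endoGL (γ₂, u) : GL (Fin 3) K) : Matrix (Fin 3) (Fin 3) K) - 1)) 1 1 • (1 : Matrix (Fin 3) (Fin 3) K)) *ᵥ ((ϖ ^ 1) • (x₀ - Pi.single 1 (x₀ 1)))) =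
          (pairing σ (!![H₂ 0 0, 0, H₂ 0 1; 0, h, 0; H₂ 1 0, 0, H₂ 1 1] : Matrix (Fin 3) (Fin 3) K) ((ϖ ^ 1) • (x₀ - Pi.single 1 (x₀ 1))) ((((((endoGL (γ₂, u) : GL (Fin 3) K) : Matrix (Fin 3) (Fin 3) K) - 1) * (((endoGL (γ₂, u) : GL (Fin 3) K) : Matrix (Fin 3) (Fin 3) K) - 1)) - ((((endoGL (γ₂, u) : GL (Fin 3) K) : Matrix (Fin 3) (Fin 3) K) - 1) * (((endoGL (γ₂, u) : GL (Fin 3) K) : Matrix (Fin 3) (Fin 3) K) - 1)) 1 1 • (1 : Matrix (Fin 3) (Fin 3) K)) *ᵥ ((ϖ ^ 1) • (x₀ - Pi.single 1 (x₀ 1)))) + ((((endoGL (γ₂, u) : GL (Fin 3) K) : Matrix (Fin 3) (Fin 3) K) - 1) * (((endoGL (γ₂, u) : GL (Fin 3) K) : Matrix (Fin 3) (Fin 3) K) - 1)) 1 1 * (pairing σ (!![H₂ 0 0, 0, H₂ 0 1; 0, h, 0; H₂ 1 0, 0, H₂ 1 1] : Matrix (Fin 3) (Fin 3) K) ((ϖ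 ^ 1) • (x₀ - Pi.single 1 (x₀ 1))) ((ϖ ^ 1) • (x₀ - Pi.single 1 (x₀ 1))) + σ (ϖ * x₀ 1) * h * (ϖ * x₀ 1))) -
            ((((endoGL (γ₂, u) : GL (Fin 3) K) : Matrix (Fin 3) (Fin 3) K) - 1) * (((endoGL (γ₂, u) : GL (Fin 3) K) : Matrix (Fin 3) (Fin 3) K) - 1)) 1 1 * (pairing σ (!![H₂ 0 0, 0, H₂ 0 1; 0, h, 0; H₂ 1 0, 0, H₂ 1 1] : Matrix (Fin 3) (Fin 3) K) ((ϖ ^ 1) • (x₀ - Pi.single 1 (x₀ 1))) ((ϖ ^ 1) • (x₀ - Pi.single 1 (x₀ 1))) + σ (ϖ * x₀ 1) * h * (ϖ * x₀ 1)) := by ring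
      rw [e]
      exact (Valuation.map_sub _ _ _).trans (max_le hsum hB'.le)
  constructor
  · rintro ⟨-, -, -, hd⟩; exact hval_iff.1 hd
  · intro hv; exact ⟨ha, hW, hc, hval_iff.2 hv⟩

end Literature.NumberTheory.Automorphic.UnitaryLatticeTree

end
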